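import Mathlib
import Summits.MatrixMultiplication.MatrixMultiplication.Theses.LevelGradedCohnUmans
import Summits.MatrixMultiplication.MatrixMultiplication.Theorems.GradedPricing.Negative.LoadBearing
import Literature.RepresentationTheory.FiniteGroups.CharacterDegrees

/-!
# Line `graded-stpp-wreath` — checked skeleton for the crux `GradedDesignFamily`
(stmt-MatrixMultiplication-7610, route `LevelGradedCohnUmans`, the route TARGET `X`, rank 0;
crux-plan round 1; idea card `Cruxes/GradedDesignFamily/Ideas/graded-stpp-wreath.md`, merged by the
triage panel with `graded-simultaneity-wreath-lift` — panel verdict pass ×4; line card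
`Lines/graded-stpp-wreath.md`; this file is published as `Lines/graded_stpp_wreath.lean`).

Crux (verbatim the route decl `…Theses.LevelGradedCohnUmans.GradedDesignFamily`): for every `ε > 0`
a finite group `G`, a BI-INVARIANT test space `J ≤ ℂ^G` and a `J`-separated triple `X, Y, Z` with
`Σᶠ_{χ ∈ Irr(G) ∩ J} χ(1)^(2+ε) < (|X||Y||Z|)^((2+ε)/3)`.

THE LINE (simultaneity instead of saturation).  `GradedDesignFamily` is EQUIVALENT to the existence,
for every `ε > 0`, of a GRADED STPP FAMILY: `n` blocks `(X_i, Y_i, Z_i)` in one finite group `H`,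
simultaneously `J`-separated in the Cohn–Kleinberg–Szegedy–Umans pattern (`JSTPPSeparated`), whose
TOTAL `Σ_i (|X_i||Y_i||Z_i|)^((2+ε)/3)` beats the graded budget (`GradedSTPPFamilyAt ε`).  The
non-trivial direction is the GRADED CKSU WREATH LIFT, cut into four registered stubs and composed
by a REAL proof (`cruxAt_of_gradedSTPPFamilyAt`); the content of the line is two more stubs.
Every stub is stated over EXISTING declarations only (Mathlib, `Literature.…irrChars`): the objects
of the lift are spelled out (`Submodule.span …`, `Fintype.piFinset …`, Mathlib's `SemidirectProduct`
with `mulAutArrow`) and bound by an equation hypothesis `J' = …` where that keeps the signature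
readable; the named abbreviations `piTests`, `wreathTests`, `liftSet`, `wordFamily`, `rankTests`
below are definitionally those expressions and are used only in the real proofs.

REGISTERED STUBS (`sorry` only here):
* `stub_powerStep`     (M/L) — `N`-th tensor power of a graded STPP family: host `Fin N → H`,
  tests `J^{⊗N}` = span of products of tests, blocks = words; (i) bi-invariance, (ii) simultaneous
  separation by products of separators, (iii) the budget law
  `Σ_{Irr(H^N) ∩ J^{⊗N}} χ(1)^s ≤ (Σ_{Irr H ∩ J} χ(1)^s)^N` (`s ≥ 0`).
* `stub_wreathSeparated` (M) — CKSU 2005 Thm 7.1 made graded: `B` simultaneously `J`-separated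
  blocks in `K` lift to ONE separated triple `(Π_b X_b) × S_B, …` in `(Fin B → K) ⋊ S_B`, for the
  bi-invariant test space `J_wr = {F : every slice F(·,π) ∈ J^{⊗B}}`.
* `stub_wreathBudget`  (L) — the graded wreath character-degree bound (CKSU's wreath degree lemma,
  graded; Clifford/Frobenius): `Σ_{Irr(K≀S_B) ∩ J_wr} χ(1)^s ≤ (B!)^(s-1) (Σ_{Irr K ∩ J} χ(1)^s)^B`,
  `s ≥ 2`.
* `stub_amplify`       (M) — the arithmetic of CKSU p. 12 (direct power + one type class +
  multinomial pigeonhole + `B! ≥ (B/e)^B`): if `S < Σ_i V_i^(s/3)` then for some `N`, `B` and `B`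
  distinct words the wreath numbers win: `(B!)^(s-1) S^(NB) < ((B!)^3 Π_b V_(word b))^(s/3)`.
* `stub_shareUniversality` (M) — "splitting the wall is free" (the card's accounting): families of
  `t ≥ 1` pieces, each filling a FIXED fraction `c` of its share `B₂/t` of the wall
  (`B₂ = Σ_{Irr∩J} χ(1)² = dim J`, `V_i ≥ c (B₂/t)^(3/2)`), with share-to-block ratio
  `B₂/(t·χ(1)²) ≥ R` unbounded along the hosts, give `GradedSTPPFamilyAt ε` for EVERY `ε`.
* `stub_lieCellFamilies` (XL, HARDEST — the open design problem) — such shared-wall families exist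
  in the Lie cells `GL_m(𝔽_p)` with the Fourier-rank-`≤ k` test space `F_k` (bi-invariant:
  `rankTests_biInvariant`, PROVED).  WEAKER than the route's crux `LevelOneGL2Designs`
  (stmt-14080 = the instance `t = 1`, `(m,k) = (2,1)`), not comparable to `LieRankDesigns`, and it
  reaches the crux only through `stub_shareUniversality` and the lift.
REAL PROOFS (no `sorry`): `JSTPPSeparated.reindex`, `gradedSTPPFamilyAt_of_cruxAt` (the trivial
direction `n = 1`: the Transfer is an equivalence), `card_liftSet`, `card_wordFamily`,
`rankTests_biInvariant`, `gradedBudget_rankTests_pos`, `sharedWall_of_lieCell`,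
`cruxAt_of_gradedSTPPFamilyAt` (THE LIFT: power step → restriction to the `B` words → wreath step →
budget chain `Σ_{J_wr} ≤ (B!)^(s-1)(Σ_{J^{⊗N}})^B ≤ (B!)^(s-1) S^(NB) < V̂^(s/3)`),
`gradedSTPPFamilyAt_all`, and `GradedDesignFamily_of`, which concludes the crux BY NAME.

Disproof.lean (cdisprove cycle 1, verdict NO KILL; read 2026-08-16) — obligations honoured:
`realizable_without_biInv/_zeros/_ones`, `realizable_with_le` (landed: `Negative/LoadBearing`):
every block of a family keeps the exact 0/1 pattern INCLUDING the cross zeros (`JSTPPSeparated`),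
the lifted test space is bi-invariant (`stub_wreathSeparated` (i)), the lifted separator is exactly
0/1 (`stub_wreathSeparated` (ii)), and the strict `<` survives the amplification (`stub_amplify` is
strict, `stub_shareUniversality` chooses `R` for a strict margin); `exists_abelian_witness_iff`
(abelian SINGLE designs only for `ε > 1`): not contradicted — the wreath host is non-abelian and the
content stubs live in `GL_m(𝔽_p)` (abelian base families with `J = ⊤` remain admissible inputs of the
lift, as CKSU Prop. 28 shows they exist; the slice-rank barriers bar them only for `ε → 0`);
`nblocks_law` / `packing_law_sharp` / `vol_le_psi`: per-design laws that the lifted design obeys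
(it IS a design) and that each block obeys with its own share; `not_gradedDesignFamily_closed`
(landed: `Negative/ExponentTwoEndpoint`): no stub claims anything at `ε = 0` —
`stub_shareUniversality` needs `ε > 0` to choose `R`, and at `ε = 0` its conclusion is false while
its hypothesis may hold, consistently.  No `-- Targets` theorems exist yet (no stuck stubs).
Negatives index: `LevelTwoBeatsCubes_refuted` (a fixed S_n level-2 cell at exponent 3) — no stub
is an instance: the content stub quantifies over Lie cells and makes no fixed-cell exponent-3 claim.
-/

set_option linter.dupNamespace false
set_option linter.unusedVariables false

noncomputable section

open scoped BigOperators
open Literature.RepresentationTheory.FiniteGroups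
open Summit.MatrixMultiplication.MatrixMultiplication.Theses.LevelGradedCohnUmans

namespace Summit.MatrixMultiplication.MatrixMultiplication.Cruxes.GradedDesignFamily.GradedStppWreath

/-! ## Vocabulary: the clauses of the crux, named (each definitionally the inline expression) -/

section Vocabulary

variable {G : Type} [Group G]

/-- Bi-invariance of a test space `J ≤ ℂ^G` (first clause of the crux). [folklore] -/
def BiInvariant (J : Submodule ℂ (G → ℂ)) : Prop :=
  ∀ f ∈ J, ∀ a b : G, (fun g : G => f (a * g * b)) ∈ J

/-- `J`-separation of one triple (second clause of the crux: TPP at the target + BCGPU24 Def 2.1).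
[cite: BlasiakCohnGrochowPrattUmans2024, Def. 2.1] -/
def JSeparated (J : Submodule ℂ (G → ℂ)) (X Y Z : Finset G) : Prop :=
  ∀ x₀ ∈ X, ∀ z₀ ∈ Z, ∃ f ∈ J, ∀ x ∈ X, ∀ y ∈ Y, ∀ y' ∈ Y, ∀ z ∈ Z,
    (x = x₀ ∧ y = y' ∧ z = z₀ → f (x⁻¹ * y * y'⁻¹ * z) = 1) ∧
    (¬ (x = x₀ ∧ y = y' ∧ z = z₀) → f (x⁻¹ * y * y'⁻¹ * z) = 0)

/-- **Graded simultaneous separation** of a family `(X i, Y i, Z i)_{i : ι}` by ONE test space `J`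
(the Cohn–Kleinberg–Szegedy–Umans STPP pattern, Def. 5.1, read through `J`): for each block `i` and
target `(x₀, z₀) ∈ X i × Z i` one `f ∈ J` reads `[j = i ∧ k = i ∧ x = x₀ ∧ y = y' ∧ z = z₀]` on every
MIXED quadruple product `x⁻¹ y y'⁻¹ z`, `(x, y) ∈ X j × Y j`, `(y', z) ∈ Y k × Z k`.
[cite: CohnKleinbergSzegedyUmans2005, Def. 5.1] -/
def JSTPPSeparated {ι : Type} (J : Submodule ℂ (G → ℂ)) (X Y Z : ι → Finset G) : Prop :=
  ∀ i : ι, ∀ x₀ ∈ X i, ∀ z₀ ∈ Z i, ∃ f ∈ J, ∀ j k : ι,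
    ∀ x ∈ X j, ∀ y ∈ Y j, ∀ y' ∈ Y k, ∀ z ∈ Z k,
      ((j = i ∧ k = i ∧ x = x₀ ∧ y = y' ∧ z = z₀) → f (x⁻¹ * y * y'⁻¹ * z) = 1) ∧
      (¬ (j = i ∧ k = i ∧ x = x₀ ∧ y = y' ∧ z = z₀) → f (x⁻¹ * y * y'⁻¹ * z) = 0)

/-- The graded budget `Σᶠ_{χ ∈ Irr(G) ∩ J} χ(1)^s` (third clause of the crux at `s = 2 + ε`).
[cite: BlasiakCohnGrochowPrattUmans2024, Thm. 2.2] -/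
def gradedBudget (J : Submodule ℂ (G → ℂ)) (s : ℝ) : ℝ :=
  ∑ᶠ χ ∈ irrChars G ∩ (J : Set (G → ℂ)), (χ 1).re ^ s

/-- Each irreducible character has `χ(1) = d ≥ 1`. [folklore] -/
theorem one_le_re_apply_one {χ : G → ℂ} (h : IsIrrChar G χ) : (1 : ℝ) ≤ (χ 1).re := by
  obtain ⟨d, -, hd⟩ := h.exists_apply_one
  have hne :=
    Summit.MatrixMultiplication.MatrixMultiplication.Theorems.GradedPricing.Negative.apply_one_ne_zero h
  rw [hd] at hne ⊢
  have : d ≠ 0 := fun h0 => hne (by simp [h0])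
  simp only [Complex.natCast_re, Nat.one_le_cast]
  omega

/-- The graded budget as a `Finset` sum. [folklore] -/
theorem gradedBudget_eq_sum [Finite G] (J : Submodule ℂ (G → ℂ)) (s : ℝ) :
    gradedBudget J s = ∑ χ ∈ ((irrChars_finite_holds G).subset
      (Set.inter_subset_left : irrChars G ∩ (J : Set (G → ℂ)) ⊆ irrChars G)).toFinset,
        (χ 1).re ^ s :=
  finsum_mem_eq_finite_toFinset_sum _ _

/-- The graded budget is non-negative. [folklore] -/
theorem gradedBudget_nonneg [Finite G] (J : Submodule ℂ (G → ℂ)) (s : ℝ) :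
    0 ≤ gradedBudget J s := by
  rw [gradedBudget_eq_sum]
  refine Finset.sum_nonneg fun χ hχ => ?_
  have h := ((Set.Finite.mem_toFinset _).1 hχ).1
  exact Real.rpow_nonneg (zero_le_one.trans (one_le_re_apply_one h)) _

/-- A sub-family (re-indexed along an injection) of a simultaneously separated family is
simultaneously separated. [folklore] -/
theorem JSTPPSeparated.reindex {ι ι' : Type} {J : Submodule ℂ (G → ℂ)} {X Y Z : ι → Finset G}
    (h : JSTPPSeparated J X Y Z) {e : ι' → ι} (he : Function.Injective e) :
    JSTPPSeparated J (X ∘ e) (Y ∘ e) (Z ∘ e) := by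
  intro i x₀ hx₀ z₀ hz₀
  obtain ⟨f, hfJ, hf⟩ := h (e i) x₀ hx₀ z₀ hz₀
  refine ⟨f, hfJ, fun j k x hx y hy y' hy' z hz => ?_⟩
  have key := hf (e j) (e k) x hx y hy y' hy' z hz
  refine ⟨fun hh => key.1 ⟨congrArg e hh.1, congrArg e hh.2.1, hh.2.2⟩, fun hh => key.2 ?_⟩
  rintro ⟨hj, hk, hrest⟩
  exact hh ⟨he hj, he hk, hrest⟩

end Vocabulary

/-- The crux's existential clause AT ONE `ε` (verbatim body of `GradedDesignFamily`). -/
def CruxAt (ε : ℝ) : Prop :=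
  ∃ (G : Type) (_ : Group G) (_ : Fintype G) (J : Submodule ℂ (G → ℂ)) (X Y Z : Finset G),
    (∀ f ∈ J, ∀ a b : G, (fun g : G => f (a * g * b)) ∈ J) ∧
    (∀ x₀ ∈ X, ∀ z₀ ∈ Z, ∃ f ∈ J, ∀ x ∈ X, ∀ y ∈ Y, ∀ y' ∈ Y, ∀ z ∈ Z,
      (x = x₀ ∧ y = y' ∧ z = z₀ → f (x⁻¹ * y * y'⁻¹ * z) = 1) ∧
      (¬ (x = x₀ ∧ y = y' ∧ z = z₀) → f (x⁻¹ * y * y'⁻¹ * z) = 0)) ∧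
    (∑ᶠ χ ∈ Literature.RepresentationTheory.FiniteGroups.irrChars G ∩ (J : Set (G → ℂ)),
      (χ 1).re ^ (2 + ε)) < ((X.card * Y.card * Z.card : ℕ) : ℝ) ^ ((2 + ε) / 3)

/-- The crux is `∀ ε > 0, CruxAt ε`, by `Iff.rfl`. -/
theorem gradedDesignFamily_iff : GradedDesignFamily ↔ ∀ ε : ℝ, 0 < ε → CruxAt ε := Iff.rfl

/-- **Graded STPP family at exponent `2 + ε`** (the Transfer `C⁺(ε)`): a finite group, a
bi-invariant `J`, `n` blocks simultaneously `J`-separated, whose `(2+ε)/3`-powers of volume out-sum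
the graded budget.  With `n = 1` it is `CruxAt ε` (`gradedSTPPFamilyAt_of_cruxAt`). -/
def GradedSTPPFamilyAt (ε : ℝ) : Prop :=
  ∃ (H : Type) (_ : Group H) (_ : Fintype H) (J : Submodule ℂ (H → ℂ)) (n : ℕ)
    (X Y Z : Fin n → Finset H),
    BiInvariant J ∧ JSTPPSeparated J X Y Z ∧
    gradedBudget J (2 + ε) <
      ∑ i, ((((X i).card * (Y i).card * (Z i).card : ℕ) : ℝ) ^ ((2 + ε) / 3))

/-- The trivial direction of the Transfer (`n = 1`): a single design is a one-block family. -/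
theorem gradedSTPPFamilyAt_of_cruxAt (ε : ℝ) : CruxAt ε → GradedSTPPFamilyAt ε := by
  rintro ⟨G, instG, instF, J, X, Y, Z, hJ, hsep, hlt⟩
  refine ⟨G, instG, instF, J, 1, fun _ => X, fun _ => Y, fun _ => Z, hJ, ?_, ?_⟩
  · intro i x₀ hx₀ z₀ hz₀
    obtain ⟨f, hfJ, hf⟩ := hsep x₀ hx₀ z₀ hz₀
    refine ⟨f, hfJ, fun j k x hx y hy y' hy' z hz => ?_⟩
    have key := hf x hx y hy y' hy' z hz
    have hj : j = i := Subsingleton.elim _ _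
    have hk : k = i := Subsingleton.elim _ _
    refine ⟨fun hall => key.1 hall.2.2, fun hnot => key.2 ?_⟩
    intro hxyz
    exact hnot ⟨hj, hk, hxyz⟩
  · simpa [gradedBudget] using hlt

/-! ## The objects of the lift (abbreviations; the stubs spell them out) -/

section Objects

variable {K : Type}

/-- The block of the `N`-th power family indexed by the word `w`: `Π_j X (w j)`.
[cite: CohnKleinbergSzegedyUmans2005, Lemma 5.4] -/
def wordFamily {n : ℕ} (N : ℕ) (X : Fin n → Finset K) (w : Fin N → Fin n) : Finset (Fin N → K) :=
  Fintype.piFinset fun j => X (w j)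

/-- `|Π_j X (w j)| = Π_j |X (w j)|`. -/
theorem card_wordFamily {n : ℕ} (N : ℕ) (X : Fin n → Finset K) (w : Fin N → Fin n) :
    (wordFamily N X w).card = ∏ j, (X (w j)).card :=
  Fintype.card_piFinset _

variable [Group K]

/-- `J^{⊗N}`: the span of the product tests `k ↦ Π_j f_j (k j)`, `f_j ∈ J`, on the direct power
`Fin N → K`. [cite: CohnKleinbergSzegedyUmans2005, Lemma 5.4] -/
def piTests (N : ℕ) (J : Submodule ℂ (K → ℂ)) : Submodule ℂ ((Fin N → K) → ℂ) :=
  Submodule.span ℂ {F : (Fin N → K) → ℂ | ∃ f : Fin N → (K → ℂ),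
    (∀ j, f j ∈ J) ∧ F = fun k => ∏ j, f j (k j)}

variable (K) (B : ℕ)

/-- The permutation wreath product `K ≀ S_B = (Fin B → K) ⋊ Perm (Fin B)`, `S_B` permuting the
coordinates (`mulAutArrow`: `(π • k) b = k (π⁻¹ b)`), so `⟨k, π⟩ * ⟨k', π'⟩ = ⟨k · (k' ∘ π⁻¹), π π'⟩`.
[cite: CohnKleinbergSzegedyUmans2005, §7] -/
abbrev Wr : Type := (Fin B → K) ⋊[mulAutArrow] Equiv.Perm (Fin B)

/-- `K ≀ S_B` is finite (Mathlib has only `SemidirectProduct.card`). -/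
instance instFintypeWr [Fintype K] : Fintype (Wr K B) :=
  Fintype.ofEquiv _ SemidirectProduct.equivProd.symm

variable {K B}

/-- The wreath test space `J_wr = {F : K ≀ S_B → ℂ | every slice F(·, π) lies in J^{⊗B}}`.
[cite: CohnKleinbergSzegedyUmans2005, Thm. 7.1] -/
def wreathTests (J : Submodule ℂ (K → ℂ)) : Submodule ℂ (Wr K B → ℂ) :=
  ⨅ π : Equiv.Perm (Fin B), (piTests B J).comap
    (LinearMap.funLeft ℂ ℂ fun k : Fin B → K => (⟨k, π⟩ : Wr K B))

/-- The CKSU lift of `B` blocks: `X̂ = (Π_b X_b) × S_B`.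
[cite: CohnKleinbergSzegedyUmans2005, Thm. 7.1] -/
def liftSet [DecidableEq K] (X : Fin B → Finset K) : Finset (Wr K B) :=
  ((Fintype.piFinset X) ×ˢ (Finset.univ : Finset (Equiv.Perm (Fin B)))).image
    fun q => (⟨q.1, q.2⟩ : Wr K B)

/-- `|X̂| = B! · Π_b |X_b|`. -/
theorem card_liftSet [DecidableEq K] (X : Fin B → Finset K) :
    (liftSet X).card = B.factorial * ∏ b, (X b).card := by
  unfold liftSet
  rw [Finset.card_image_of_injective]
  · rw [Finset.card_product, Fintype.card_piFinset, Finset.card_univ, Fintype.card_perm,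
      Fintype.card_fin, mul_comm]
  · intro p q h
    exact Prod.ext (by simpa using congrArg SemidirectProduct.left h)
      (by simpa using congrArg SemidirectProduct.right h)

end Objects

/-! ## Registered stubs 1–4: the graded CKSU wreath lift (`sorry` only in `stub_*`) -/

/-- **stub_powerStep (M/L) — STPP powers, graded** (CKSU Lemma 5.4 read through `J`).  If `n`
blocks in `K` are simultaneously `J`-separated (`J` bi-invariant) then, in the direct power
`Fin N → K` with the test space `J' = J^{⊗N}` (span of the products `k ↦ Π_j f_j (k j)`, `f_j ∈ J`):
(i) `J'` is bi-invariant (translate each factor); (ii) the word family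
`(Π_j X (w j), Π_j Y (w j), Π_j Z (w j))_{w : Fin N → Fin n}` is simultaneously `J'`-separated
(separator of the target word `w₀`, `(x₀, z₀)`: `k ↦ Π_j f_j (k j)` with `f_j` the separator of
block `w₀ j`, target `(x₀ j, z₀ j)`; a product of 0/1's is the conjunction, and two words agree iff
they agree at every letter); (iii) the budget law
`Σᶠ_{χ ∈ Irr(K^N) ∩ J'} χ(1)^s ≤ (Σᶠ_{χ ∈ Irr K ∩ J} χ(1)^s)^N` for `s ≥ 0` (the irreducible
characters of `K^N` are the products `⊗_j ψ_j`; an elementary tensor lies in `J^{⊗N}` only if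
every factor lies in `J`; then `Σ Π_j d_j^s = (Σ d^s)^N`, equality in fact).
[cite: CohnKleinbergSzegedyUmans2005, Lemma 5.4] -/
theorem stub_powerStep {K : Type} [Group K] [Fintype K] (J : Submodule ℂ (K → ℂ))
    (hJ : ∀ f ∈ J, ∀ a b : K, (fun g : K => f (a * g * b)) ∈ J)
    {n : ℕ} (X Y Z : Fin n → Finset K)
    (hsep : ∀ i : Fin n, ∀ x₀ ∈ X i, ∀ z₀ ∈ Z i, ∃ f ∈ J, ∀ j k : Fin n,
      ∀ x ∈ X j, ∀ y ∈ Y j, ∀ y' ∈ Y k, ∀ z ∈ Z k,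
        ((j = i ∧ k = i ∧ x = x₀ ∧ y = y' ∧ z = z₀) → f (x⁻¹ * y * y'⁻¹ * z) = 1) ∧
        (¬ (j = i ∧ k = i ∧ x = x₀ ∧ y = y' ∧ z = z₀) → f (x⁻¹ * y * y'⁻¹ * z) = 0))
    (N : ℕ) (J' : Submodule ℂ ((Fin N → K) → ℂ))
    (hJ' : J' = Submodule.span ℂ {F : (Fin N → K) → ℂ | ∃ f : Fin N → (K → ℂ),
      (∀ j, f j ∈ J) ∧ F = fun k => ∏ j, f j (k j)}) :
    (∀ F ∈ J', ∀ a b : Fin N → K, (fun g : Fin N → K => F (a * g * b)) ∈ J') ∧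
    (∀ i : Fin N → Fin n, ∀ x₀ ∈ Fintype.piFinset (fun j => X (i j)),
      ∀ z₀ ∈ Fintype.piFinset (fun j => Z (i j)), ∃ F ∈ J', ∀ u v : Fin N → Fin n,
      ∀ x ∈ Fintype.piFinset (fun j => X (u j)), ∀ y ∈ Fintype.piFinset (fun j => Y (u j)),
      ∀ y' ∈ Fintype.piFinset (fun j => Y (v j)), ∀ z ∈ Fintype.piFinset (fun j => Z (v j)),
        ((u = i ∧ v = i ∧ x = x₀ ∧ y = y' ∧ z = z₀) → F (x⁻¹ * y * y'⁻¹ * z) = 1) ∧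
        (¬ (u = i ∧ v = i ∧ x = x₀ ∧ y = y' ∧ z = z₀) → F (x⁻¹ * y * y'⁻¹ * z) = 0)) ∧
    (∀ s : ℝ, 0 ≤ s →
      (∑ᶠ χ ∈ Literature.RepresentationTheory.FiniteGroups.irrChars (Fin N → K) ∩
          (J' : Set ((Fin N → K) → ℂ)), (χ 1).re ^ s) ≤
        (∑ᶠ χ ∈ Literature.RepresentationTheory.FiniteGroups.irrChars K ∩ (J : Set (K → ℂ)),
          (χ 1).re ^ s) ^ N) := by
  sorry

/-- **stub_wreathSeparated (M) — the graded wreath step, separation half (CKSU Thm. 7.1).**  `B`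
blocks in `K`, simultaneously `J`-separated (`J` bi-invariant); `G' = (Fin B → K) ⋊ S_B` with
Mathlib's `SemidirectProduct` and `mulAutArrow` (`(π • k) b = k (π⁻¹ b)`); `J'` = the wreath test
space `{F : G' → ℂ | every slice k ↦ F ⟨k, π⟩ lies in J^{⊗B}}`; `X' = (Π_b X_b) × S_B` etc.  Then
(i) `J'` is bi-invariant under `G'` (a two-sided translate of a slice is a coordinate-permuted product
of two-sided translates of the factors), and (ii) `(X', Y', Z')` is `J'`-separated.  Computation:
for `x̂ = ⟨x, π⟩, ŷ = ⟨y, σ⟩, ŷ' = ⟨y', σ'⟩, ẑ = ⟨z, τ⟩`, `x̂⁻¹ ŷ ŷ'⁻¹ ẑ = ⟨k, π⁻¹σσ'⁻¹τ⟩` with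
`k b = x(π b)⁻¹ y(π b) · y'(m b)⁻¹ z(m b)`, `m = σ'σ⁻¹π` (an `A`-pair of block `π b` times a `B`-pair
of block `m b` — the STPP pattern); the separator of the target `(⟨x⁰, π₀⟩, ⟨z⁰, τ₀⟩)` is
`F ⟨k, ρ⟩ = [ρ = π₀⁻¹τ₀] · Π_b f_b (k b)`, `f_b` the simultaneous separator of block `π₀ b`, target
`(x⁰ (π₀ b), z⁰ (π₀ b))`; block matching at every coordinate forces `π = π₀`, `σ = σ'`, then
`τ = τ₀` and the coordinates; every slice of `F` is `0` or a product test, so `F ∈ J'`.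
[cite: CohnKleinbergSzegedyUmans2005, Thm. 7.1] -/
theorem stub_wreathSeparated {K : Type} [Group K] [DecidableEq K] {B : ℕ}
    (J : Submodule ℂ (K → ℂ))
    (hJ : ∀ f ∈ J, ∀ a b : K, (fun g : K => f (a * g * b)) ∈ J)
    (X Y Z : Fin B → Finset K)
    (hsep : ∀ i : Fin B, ∀ x₀ ∈ X i, ∀ z₀ ∈ Z i, ∃ f ∈ J, ∀ j k : Fin B,
      ∀ x ∈ X j, ∀ y ∈ Y j, ∀ y' ∈ Y k, ∀ z ∈ Z k,
        ((j = i ∧ k = i ∧ x = x₀ ∧ y = y' ∧ z = z₀) → f (x⁻¹ * y * y'⁻¹ * z) = 1) ∧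
        (¬ (j = i ∧ k = i ∧ x = x₀ ∧ y = y' ∧ z = z₀) → f (x⁻¹ * y * y'⁻¹ * z) = 0))
    (J' : Submodule ℂ (((Fin B → K) ⋊[mulAutArrow] Equiv.Perm (Fin B)) → ℂ))
    (hJ' : J' = ⨅ π : Equiv.Perm (Fin B),
      (Submodule.span ℂ {F : (Fin B → K) → ℂ | ∃ f : Fin B → (K → ℂ),
        (∀ b, f b ∈ J) ∧ F = fun k => ∏ b, f b (k b)}).comap
      (LinearMap.funLeft ℂ ℂ fun k : Fin B → K =>
        (⟨k, π⟩ : (Fin B → K) ⋊[mulAutArrow] Equiv.Perm (Fin B))))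
    (X' Y' Z' : Finset ((Fin B → K) ⋊[mulAutArrow] Equiv.Perm (Fin B)))
    (hX' : X' = ((Fintype.piFinset X) ×ˢ (Finset.univ : Finset (Equiv.Perm (Fin B)))).image
      fun q => (⟨q.1, q.2⟩ : (Fin B → K) ⋊[mulAutArrow] Equiv.Perm (Fin B)))
    (hY' : Y' = ((Fintype.piFinset Y) ×ˢ (Finset.univ : Finset (Equiv.Perm (Fin B)))).image
      fun q => (⟨q.1, q.2⟩ : (Fin B → K) ⋊[mulAutArrow] Equiv.Perm (Fin B)))
    (hZ' : Z' = ((Fintype.piFinset Z) ×ˢ (Finset.univ : Finset (Equiv.Perm (Fin B)))).image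
      fun q => (⟨q.1, q.2⟩ : (Fin B → K) ⋊[mulAutArrow] Equiv.Perm (Fin B))) :
    (∀ F ∈ J', ∀ a b : (Fin B → K) ⋊[mulAutArrow] Equiv.Perm (Fin B),
      (fun g : (Fin B → K) ⋊[mulAutArrow] Equiv.Perm (Fin B) => F (a * g * b)) ∈ J') ∧
    (∀ x₀ ∈ X', ∀ z₀ ∈ Z', ∃ F ∈ J', ∀ x ∈ X', ∀ y ∈ Y', ∀ y' ∈ Y', ∀ z ∈ Z',
      (x = x₀ ∧ y = y' ∧ z = z₀ → F (x⁻¹ * y * y'⁻¹ * z) = 1) ∧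
      (¬ (x = x₀ ∧ y = y' ∧ z = z₀) → F (x⁻¹ * y * y'⁻¹ * z) = 0)) := by
  sorry

/-- **stub_wreathBudget (L) — the graded wreath character-degree bound** (CKSU's lemma
`Σ c_j^ω ≤ (n!)^(ω-1) (Σ d_k^ω)^n`, made graded).  For bi-invariant `J`, the wreath test space `J'` of
`stub_wreathSeparated` and `s ≥ 2`:
`Σᶠ_{χ ∈ Irr(K ≀ S_B) ∩ J'} χ(1)^s ≤ (B!)^(s-1) · (Σᶠ_{ψ ∈ Irr K ∩ J} ψ(1)^s)^B`.
Route: the slice `k ↦ χ ⟨k, 1⟩ = Res_N χ` (`N = K^B ⊴ K ≀ S_B`, index `B!`) lies in `J^{⊗B}`, a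
bi-invariant space whose irreducible constituents are the `ψ⃗ = ⊗ψ_b` with all `ψ_b ∈ Irr K ∩ J`
(`stub_powerStep` (iii)); Clifford: the constituents of `Res_N χ` form one `S_B`-orbit `O` with a
common multiplicity `e_χ`, `χ(1) = e_χ |O| d_O`, `d_O = Π ψ_b(1)`; Frobenius reciprocity on
`Ind_N ψ⃗` gives `Σ_{χ over O} e_χ² = B!/|O|`, hence `Σ_{χ over O} χ(1)^s ≤ (B! |O|)^(s/2) d_O^s ≤
(B!)^(s-1) |O| d_O^s` (`|O| ≤ B!`, `s ≥ 2`); sum over the orbits of `(Irr K ∩ J)^B`.  (Fallback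
if Clifford is too dear in Lean: `χ(1) ≤ B!·δ^B` from `‖Res_N χ‖² ≤ [K≀S_B : N]` and
`Σ χ(1)² ≤ dim J' = B!·(dim J)^B` give `≤ (B!)^(s-1) (δ^(s-2) Σ_{Irr K∩J} ψ(1)²)^B`, weaker by the
factor `E_{d²}[(d/δ)^(s-2)]^B` — enough for cells with comparable degrees, NOT what is registered.)
[cite: CohnKleinbergSzegedyUmans2005, Thm. 7.1] -/
theorem stub_wreathBudget {K : Type} [Group K] [Fintype K] {B : ℕ} (J : Submodule ℂ (K → ℂ))
    (hJ : ∀ f ∈ J, ∀ a b : K, (fun g : K => f (a * g * b)) ∈ J)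
    (s : ℝ) (hs : 2 ≤ s)
    (J' : Submodule ℂ (((Fin B → K) ⋊[mulAutArrow] Equiv.Perm (Fin B)) → ℂ))
    (hJ' : J' = ⨅ π : Equiv.Perm (Fin B),
      (Submodule.span ℂ {F : (Fin B → K) → ℂ | ∃ f : Fin B → (K → ℂ),
        (∀ b, f b ∈ J) ∧ F = fun k => ∏ b, f b (k b)}).comap
      (LinearMap.funLeft ℂ ℂ fun k : Fin B → K =>
        (⟨k, π⟩ : (Fin B → K) ⋊[mulAutArrow] Equiv.Perm (Fin B)))) :
    (∑ᶠ χ ∈ Literature.RepresentationTheory.FiniteGroups.irrChars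
          ((Fin B → K) ⋊[mulAutArrow] Equiv.Perm (Fin B)) ∩
        (J' : Set (((Fin B → K) ⋊[mulAutArrow] Equiv.Perm (Fin B)) → ℂ)), (χ 1).re ^ s) ≤
      (B.factorial : ℝ) ^ (s - 1) *
        (∑ᶠ χ ∈ Literature.RepresentationTheory.FiniteGroups.irrChars K ∩ (J : Set (K → ℂ)),
          (χ 1).re ^ s) ^ B := by
  sorry

/-- **stub_amplify (M) — direct power + one type class + the wreath numbers win** (the arithmetic
of CKSU 2005, proof of Thm. 5.5, p. 12 of arXiv:math/0511460).  If `S < Σ_i (x_i y_i z_i)^(s/3)`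
(`S ≥ 0`, `s > 0`) then there are `N`, `B` and `B` DISTINCT words `e b : Fin N → Fin n` with
`(B!)^(s-1) · S^(N B) < ((B! Π_b Π_j x_(e b j)) (B! Π_b Π_j y_(e b j)) (B! Π_b Π_j z_(e b j)))^(s/3)`.
Route: take the words of ONE type `μ` (`B = multinomial(N; μ)`, all of volume
`V_μ = Π_i V_i^(μ_i)`), so the claim is `S^(NB) < B! · V_μ^(B s/3)`; by `B! ≥ (B/e)^B` it suffices
that `e · S^N < B · V_μ^(s/3) = multinomial(N;μ) Π_i (V_i^(s/3))^(μ_i)`; the LARGEST term of the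
multinomial expansion of `(Σ_i V_i^(s/3))^N` is `≥ (Σ_i V_i^(s/3))^N / (N+1)^n`, and
`(Σ_i V_i^(s/3) / S)^N` beats `e (N+1)^n` for `N` large (`S = 0`: `N = B = 1`, one word on a block
of positive volume). [cite: CohnKleinbergSzegedyUmans2005, Thm. 5.5] -/
theorem stub_amplify {n : ℕ} (x y z : Fin n → ℕ) (S s : ℝ) (hS : 0 ≤ S) (hs : 0 < s)
    (h : S < ∑ i, ((x i * y i * z i : ℕ) : ℝ) ^ (s / 3)) :
    ∃ (N B : ℕ) (e : Fin B ↪ (Fin N → Fin n)),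
      (B.factorial : ℝ) ^ (s - 1) * (S ^ N) ^ B <
        ((((B.factorial * ∏ b, ∏ j, x (e b j)) * (B.factorial * ∏ b, ∏ j, y (e b j)) *
          (B.factorial * ∏ b, ∏ j, z (e b j)) : ℕ) : ℝ)) ^ (s / 3) := by
  sorry

/-! ## The lift (REAL proof from stubs 1–4) -/

/-- **THE GRADED CKSU WREATH LIFT** `GradedSTPPFamilyAt ε → CruxAt ε`: power step (`stub_powerStep`),
restriction to the `B` words of `stub_amplify` (`JSTPPSeparated.reindex`), wreath step
(`stub_wreathSeparated`), budget chain `Σ_{J_wr} ≤ (B!)^(s-1) (Σ_{J^{⊗N}})^B ≤ (B!)^(s-1) S^(NB) <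
V̂^(s/3)` (`stub_wreathBudget`, `stub_powerStep` (iii), `stub_amplify`, `card_liftSet`,
`card_wordFamily`).  Together with `gradedSTPPFamilyAt_of_cruxAt` the Transfer is an EQUIVALENCE.
[cite: CohnKleinbergSzegedyUmans2005, Thm. 7.1] -/
theorem cruxAt_of_gradedSTPPFamilyAt {ε : ℝ} (hε : 0 < ε) (hfam : GradedSTPPFamilyAt ε) :
    CruxAt ε := by
  classical
  obtain ⟨H, instH, instF, J, n, X, Y, Z, hJ, hsep, hlt⟩ := hfam
  set s : ℝ := 2 + ε with hs_def
  have hs0 : 0 < s := by rw [hs_def]; linarith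
  have hs2 : 2 ≤ s := by rw [hs_def]; linarith
  have hS0 : 0 ≤ gradedBudget J s := gradedBudget_nonneg J s
  -- the arithmetic: `N`-th power, `B` words `e b`
  obtain ⟨N, B, e, hamp⟩ := stub_amplify (fun i => (X i).card) (fun i => (Y i).card)
    (fun i => (Z i).card) (gradedBudget J s) s hS0 hs0 hlt
  -- the power step
  obtain ⟨hJ', hsep', hbud'⟩ := stub_powerStep J hJ X Y Z hsep N (piTests N J) rfl
  have hsepP : JSTPPSeparated (piTests N J) (wordFamily N X) (wordFamily N Y) (wordFamily N Z) :=
    hsep'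
  -- the sub-family of the `B` words
  have hsepB : JSTPPSeparated (piTests N J) (wordFamily N X ∘ e) (wordFamily N Y ∘ e)
      (wordFamily N Z ∘ e) := hsepP.reindex e.injective
  -- the wreath step
  obtain ⟨hJ'', hsepW⟩ := stub_wreathSeparated (piTests N J) hJ' (wordFamily N X ∘ e)
    (wordFamily N Y ∘ e) (wordFamily N Z ∘ e) hsepB (wreathTests (piTests N J)) rfl
    (liftSet (wordFamily N X ∘ e)) (liftSet (wordFamily N Y ∘ e)) (liftSet (wordFamily N Z ∘ e))
    rfl rfl rfl
  have hbudW := stub_wreathBudget (piTests N J) hJ' s hs2 (wreathTests (B := B) (piTests N J)) rfl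
  refine ⟨Wr (Fin N → H) B, inferInstance, inferInstance, wreathTests (piTests N J),
    liftSet (wordFamily N X ∘ e), liftSet (wordFamily N Y ∘ e), liftSet (wordFamily N Z ∘ e),
    hJ'', hsepW, ?_⟩
  -- volume bookkeeping
  have hx : (liftSet (wordFamily N X ∘ e)).card = B.factorial * ∏ b, ∏ j, (X (e b j)).card := by
    rw [card_liftSet]
    congr 1
    exact Finset.prod_congr rfl fun b _ => by rw [Function.comp_apply, card_wordFamily]
  have hy : (liftSet (wordFamily N Y ∘ e)).card = B.factorial * ∏ b, ∏ j, (Y (e b j)).card := by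
    rw [card_liftSet]
    congr 1
    exact Finset.prod_congr rfl fun b _ => by rw [Function.comp_apply, card_wordFamily]
  have hz : (liftSet (wordFamily N Z ∘ e)).card = B.factorial * ∏ b, ∏ j, (Z (e b j)).card := by
    rw [card_liftSet]
    congr 1
    exact Finset.prod_congr rfl fun b _ => by rw [Function.comp_apply, card_wordFamily]
  -- budget chain
  have hpow : gradedBudget (piTests N J) s ^ B ≤ (gradedBudget J s ^ N) ^ B :=
    pow_le_pow_left₀ (gradedBudget_nonneg _ s) (hbud' s hs0.le) B
  have hfac : 0 ≤ (B.factorial : ℝ) ^ (s - 1) := Real.rpow_nonneg (Nat.cast_nonneg _) _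
  show gradedBudget (wreathTests (piTests N J)) s < _
  rw [hx, hy, hz]
  calc gradedBudget (wreathTests (piTests N J)) s
      ≤ (B.factorial : ℝ) ^ (s - 1) * gradedBudget (piTests N J) s ^ B := hbudW
    _ ≤ (B.factorial : ℝ) ^ (s - 1) * (gradedBudget J s ^ N) ^ B :=
        mul_le_mul_of_nonneg_left hpow hfac
    _ < _ := hamp

/-! ## Registered stub 5: splitting the wall is free (host-free universality) -/

/-- **Shared-wall families** (the card's accounting made a statement): a FIXED filling fraction
`c > 0` such that for every ratio `R` some finite host `G` with a bi-invariant `J` carries `t ≥ 1`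
simultaneously `J`-separated blocks, each filling the fraction `c` of its share `B₂/t` of the wall
(`B₂ = Σ_{Irr ∩ J} χ(1)² = dim J > 0`, `V_i ≥ c (B₂/t)^(3/2)`), while every visible irreducible has
`R · t · χ(1)² ≤ B₂` (share-to-block ratio `N_eff/t ≥ R`).  Verbatim the hypothesis of
`stub_shareUniversality`. [cite: CohnKleinbergSzegedyUmans2005, Thm. 5.5] -/
def SharedWallFamilies : Prop :=
  ∃ c : ℝ, 0 < c ∧ ∀ R : ℝ, ∃ (G : Type) (_ : Group G) (_ : Fintype G) (J : Submodule ℂ (G → ℂ))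
    (B₂ : ℝ) (t : ℕ) (X Y Z : Fin t → Finset G),
    B₂ = gradedBudget J 2 ∧ BiInvariant J ∧ JSTPPSeparated J X Y Z ∧ 1 ≤ t ∧ 0 < B₂ ∧
    (∀ i, c * (B₂ / t) ^ (3 / 2 : ℝ) ≤ ((((X i).card * (Y i).card * (Z i).card : ℕ) : ℝ))) ∧
    (∀ χ ∈ irrChars G ∩ (J : Set (G → ℂ)), R * t * (χ 1).re ^ 2 ≤ B₂)

/-- **stub_shareUniversality (M) — splitting the wall among `t ≤ N_eff/R` pieces is free.**
Shared-wall families (`hfam`, see `SharedWallFamilies`) give a graded STPP family at EVERY exponent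
`2 + ε`, `ε > 0` (the conclusion is verbatim `GradedSTPPFamilyAt ε`).  Proof (power means,
host-free): with `s = 2 + ε` and `B₂ = Σ_{Irr∩J} d²`, the hypothesis `R t d² ≤ B₂` gives
`d^ε ≤ (B₂/(R t))^(ε/2)` for every visible `χ`, so `Σ_{Irr∩J} d^s ≤ B₂ (B₂/t)^(ε/2) R^(-ε/2)`; the
pieces give `Σ_i V_i^(s/3) ≥ t · c^(s/3) (B₂/t)^(s/2) = c^(s/3) B₂ (B₂/t)^(ε/2)`; take the host for an
`R ≥ 1` with `c^(s/3) R^(ε/2) > 1` (`B₂ > 0` and `t ≥ 1` make the comparison strict; the budget is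
the `Finset` sum `gradedBudget_eq_sum` of terms `d^s = d² · d^ε`, `d ≥ 1`).
[cite: CohnKleinbergSzegedyUmans2005, Thm. 5.5] -/
theorem stub_shareUniversality (c : ℝ) (hc : 0 < c)
    (hfam : ∀ R : ℝ, ∃ (G : Type) (_ : Group G) (_ : Fintype G) (J : Submodule ℂ (G → ℂ))
      (B₂ : ℝ) (t : ℕ) (X Y Z : Fin t → Finset G),
      B₂ = (∑ᶠ χ ∈ Literature.RepresentationTheory.FiniteGroups.irrChars G ∩ (J : Set (G → ℂ)),
        (χ 1).re ^ (2 : ℝ)) ∧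
      (∀ f ∈ J, ∀ a b : G, (fun g : G => f (a * g * b)) ∈ J) ∧
      (∀ i : Fin t, ∀ x₀ ∈ X i, ∀ z₀ ∈ Z i, ∃ f ∈ J, ∀ j k : Fin t,
        ∀ x ∈ X j, ∀ y ∈ Y j, ∀ y' ∈ Y k, ∀ z ∈ Z k,
          ((j = i ∧ k = i ∧ x = x₀ ∧ y = y' ∧ z = z₀) → f (x⁻¹ * y * y'⁻¹ * z) = 1) ∧
          (¬ (j = i ∧ k = i ∧ x = x₀ ∧ y = y' ∧ z = z₀) → f (x⁻¹ * y * y'⁻¹ * z) = 0)) ∧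
      1 ≤ t ∧ 0 < B₂ ∧
      (∀ i, c * (B₂ / t) ^ (3 / 2 : ℝ) ≤ ((((X i).card * (Y i).card * (Z i).card : ℕ) : ℝ))) ∧
      (∀ χ ∈ Literature.RepresentationTheory.FiniteGroups.irrChars G ∩ (J : Set (G → ℂ)),
        R * t * (χ 1).re ^ 2 ≤ B₂))
    (ε : ℝ) (hε : 0 < ε) :
    ∃ (H : Type) (_ : Group H) (_ : Fintype H) (J : Submodule ℂ (H → ℂ)) (n : ℕ)
      (X Y Z : Fin n → Finset H),
      (∀ f ∈ J, ∀ a b : H, (fun g : H => f (a * g * b)) ∈ J) ∧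
      (∀ i : Fin n, ∀ x₀ ∈ X i, ∀ z₀ ∈ Z i, ∃ f ∈ J, ∀ j k : Fin n,
        ∀ x ∈ X j, ∀ y ∈ Y j, ∀ y' ∈ Y k, ∀ z ∈ Z k,
          ((j = i ∧ k = i ∧ x = x₀ ∧ y = y' ∧ z = z₀) → f (x⁻¹ * y * y'⁻¹ * z) = 1) ∧
          (¬ (j = i ∧ k = i ∧ x = x₀ ∧ y = y' ∧ z = z₀) → f (x⁻¹ * y * y'⁻¹ * z) = 0)) ∧
      (∑ᶠ χ ∈ Literature.RepresentationTheory.FiniteGroups.irrChars H ∩ (J : Set (H → ℂ)),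
        (χ 1).re ^ (2 + ε)) <
        ∑ i, ((((X i).card * (Y i).card * (Z i).card : ℕ) : ℝ) ^ ((2 + ε) / 3)) := by
  sorry

/-! ## Registered stub 6 (HARDEST): shared-wall families in the Lie cells -/

section LieCell

variable (p m k : ℕ) [Fact p.Prime]

/-- The Fourier-rank-`≤ k` test space `F_k` of `GL_m(𝔽_p)` (the route's Lie-engine grading; here
the span of the characters `g ↦ ψ(tr(M g))`, `rk M ≤ k`, `ψ = ZMod.stdAddChar` — the coefficient
space of the permutation module on `k`-frames; as a SET of functions it is the route's
`{f | ∃ c, (∀ M, k < rk M → c M = 0) ∧ f = Σ_M c M ψ(tr(M ·))}` of `LieRankDesigns`).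
[cite: GurevichHowe2017, Def. 1.1] -/
def rankTests : Submodule ℂ (Matrix.GeneralLinearGroup (Fin m) (ZMod p) → ℂ) :=
  Submodule.span ℂ {f | ∃ M : Matrix (Fin m) (Fin m) (ZMod p), M.rank ≤ k ∧
    f = fun g : Matrix.GeneralLinearGroup (Fin m) (ZMod p) =>
      (ZMod.stdAddChar (Matrix.trace (M * (g : Matrix (Fin m) (Fin m) (ZMod p)))) : ℂ)}

/-- The two-sided translation operator `f ↦ (g ↦ f (a g b))`. [folklore] -/
def biTranslate {G : Type} [Group G] (a b : G) : (G → ℂ) →ₗ[ℂ] (G → ℂ) where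
  toFun f := fun g => f (a * g * b)
  map_add' f₁ f₂ := by ext g; simp
  map_smul' c f := by ext g; simp

/-- `tr(M · (A G B)) = tr((B M A) · G)`. [folklore] -/
theorem trace_conj_aux (M A G B : Matrix (Fin m) (Fin m) (ZMod p)) :
    Matrix.trace (M * (A * G * B)) = Matrix.trace (B * M * A * G) := by
  rw [show M * (A * G * B) = (M * A * G) * B by simp only [mul_assoc], Matrix.trace_mul_comm,
    show B * (M * A * G) = B * M * A * G by simp only [mul_assoc]]

/-- `F_k` is bi-invariant: `tr(M · a g b) = tr((b M a) · g)` and `rk(b M a) ≤ rk M`. [folklore] -/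
theorem rankTests_biInvariant : BiInvariant (rankTests p m k) := by
  intro f hf a b
  have hgen : ∀ f ∈ {f | ∃ M : Matrix (Fin m) (Fin m) (ZMod p), M.rank ≤ k ∧
      f = fun g : Matrix.GeneralLinearGroup (Fin m) (ZMod p) => (ZMod.stdAddChar (Matrix.trace
        (M * (g : Matrix (Fin m) (Fin m) (ZMod p)))) : ℂ)},
      biTranslate a b f ∈ rankTests p m k := by
    rintro f ⟨M, hM, rfl⟩
    apply Submodule.subset_span
    refine ⟨(b : Matrix (Fin m) (Fin m) (ZMod p)) * M * (a : Matrix (Fin m) (Fin m) (ZMod p)),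
      ?_, ?_⟩
    · exact (Matrix.rank_mul_le_left _ _).trans ((Matrix.rank_mul_le_right _ _).trans hM)
    · funext g
      simp only [biTranslate, LinearMap.coe_mk, AddHom.coe_mk, Units.val_mul]
      congr 1
      exact trace_conj_aux p m M _ _ _
  have hmap : Submodule.map (biTranslate a b) (rankTests p m k) ≤ rankTests p m k := by
    unfold rankTests
    rw [Submodule.map_span]
    apply Submodule.span_le.mpr
    rintro _ ⟨f, hfS, rfl⟩
    exact hgen f hfS
  exact hmap (Submodule.mem_map_of_mem hf)

/-- The trivial character lies in `F_k` (`M = 0`), so the wall `B₂(F_k)` is positive. [folklore] -/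
theorem gradedBudget_rankTests_pos : 0 < gradedBudget (rankTests p m k) 2 := by
  have h1 : (1 : Matrix.GeneralLinearGroup (Fin m) (ZMod p) → ℂ) ∈ rankTests p m k := by
    apply Submodule.subset_span
    refine ⟨0, by simp, ?_⟩
    funext g
    simp
  have hmem : (1 : Matrix.GeneralLinearGroup (Fin m) (ZMod p) → ℂ) ∈
      irrChars (Matrix.GeneralLinearGroup (Fin m) (ZMod p)) ∩
        (rankTests p m k : Set (Matrix.GeneralLinearGroup (Fin m) (ZMod p) → ℂ)) :=
    ⟨Summit.MatrixMultiplication.MatrixMultiplication.Theorems.GradedPricing.Negative.one_mem_irrChars,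
      h1⟩
  have hfin : (irrChars (Matrix.GeneralLinearGroup (Fin m) (ZMod p)) ∩
      (rankTests p m k : Set (Matrix.GeneralLinearGroup (Fin m) (ZMod p) → ℂ))).Finite :=
    (irrChars_finite_holds _).subset Set.inter_subset_left
  unfold gradedBudget
  rw [finsum_mem_eq_finite_toFinset_sum _ hfin]
  have hle : ((1 : Matrix.GeneralLinearGroup (Fin m) (ZMod p) → ℂ) 1).re ^ (2 : ℝ) ≤
      ∑ χ ∈ hfin.toFinset, (χ 1).re ^ (2 : ℝ) := by
    refine Finset.single_le_sum (f := fun χ : Matrix.GeneralLinearGroup (Fin m) (ZMod p) → ℂ =>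
      (χ 1).re ^ (2 : ℝ)) (fun χ hχ => ?_) (hfin.mem_toFinset.2 hmem)
    have h := (hfin.mem_toFinset.1 hχ).1
    exact Real.rpow_nonneg (zero_le_one.trans (one_le_re_apply_one h)) _
  refine lt_of_lt_of_le ?_ hle
  simp

end LieCell

/-- **stub_lieCellFamilies (XL, HARDEST) — shared-wall families in the Lie cells** (the open
design problem of the line; its conclusion is verbatim the hypothesis `hfam` of
`stub_shareUniversality` with `G = GL_m(𝔽_p)` and `J = F` the Fourier-rank-`≤ k` test space, cf.
`rankTests`): a fixed filling fraction `c > 0` and, for every ratio `R`, a cell `(p, m, k)`, `t ≥ 1`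
and `t` blocks `(X_i, Y_i, Z_i)` in `GL_m(𝔽_p)` simultaneously separated by Fourier-rank-`≤ k` tests,
each of volume `≥ c (B₂/t)^(3/2)` (`B₂ = Σ_{Irr ∩ F_k} χ(1)² = dim F_k ≈ p^(2mk-k²)`), with
`R t χ(1)² ≤ B₂` for every `χ ∈ Irr ∩ F_k` (i.e. `t ≤ N_eff/R`, `N_eff = B₂/d_max² ≈ p^k`; `0 < B₂`
holds automatically, `gradedBudget_rankTests_pos`).  Candidates (card §(ii)–(iii)): blocks =
cosets / `O(1)`-unions of cosets of algebraic subgroups of side `d_max (N_eff/t)^(1/2)` (thickened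
root groups `U ⋊ C` at `(2,1)`; Levi/Borel pieces at level `k ≥ 2`, the card's natural home),
indexed by a difference-set design on `G/B` so that the `O(1)` cross-conditions are symbolic in
`p`; the instance `t = 1`, `(m,k) = (2,1)` is implied by the route's crux `LevelOneGL2Designs`
(stmt-14080), so this stub is WEAKER than an existing crux of the route.
[cite: CohnKleinbergSzegedyUmans2005, Thm. 7.1] -/
theorem stub_lieCellFamilies :
    ∃ c : ℝ, 0 < c ∧ ∀ R : ℝ, ∃ (p : ℕ) (_ : Fact p.Prime) (m k : ℕ)
      (F : Submodule ℂ (Matrix.GeneralLinearGroup (Fin m) (ZMod p) → ℂ)) (B₂ : ℝ) (t : ℕ)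
      (X Y Z : Fin t → Finset (Matrix.GeneralLinearGroup (Fin m) (ZMod p))),
      F = Submodule.span ℂ {f | ∃ M : Matrix (Fin m) (Fin m) (ZMod p), M.rank ≤ k ∧
        f = fun g : Matrix.GeneralLinearGroup (Fin m) (ZMod p) =>
          (ZMod.stdAddChar (Matrix.trace (M * (g : Matrix (Fin m) (Fin m) (ZMod p)))) : ℂ)} ∧
      B₂ = (∑ᶠ χ ∈ Literature.RepresentationTheory.FiniteGroups.irrChars
          (Matrix.GeneralLinearGroup (Fin m) (ZMod p)) ∩
        (F : Set (Matrix.GeneralLinearGroup (Fin m) (ZMod p) → ℂ)), (χ 1).re ^ (2 : ℝ)) ∧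
      (∀ i : Fin t, ∀ x₀ ∈ X i, ∀ z₀ ∈ Z i, ∃ f ∈ F, ∀ j k : Fin t,
        ∀ x ∈ X j, ∀ y ∈ Y j, ∀ y' ∈ Y k, ∀ z ∈ Z k,
          ((j = i ∧ k = i ∧ x = x₀ ∧ y = y' ∧ z = z₀) → f (x⁻¹ * y * y'⁻¹ * z) = 1) ∧
          (¬ (j = i ∧ k = i ∧ x = x₀ ∧ y = y' ∧ z = z₀) → f (x⁻¹ * y * y'⁻¹ * z) = 0)) ∧
      1 ≤ t ∧
      (∀ i, c * (B₂ / t) ^ (3 / 2 : ℝ) ≤ ((((X i).card * (Y i).card * (Z i).card : ℕ) : ℝ))) ∧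
      (∀ χ ∈ Literature.RepresentationTheory.FiniteGroups.irrChars
          (Matrix.GeneralLinearGroup (Fin m) (ZMod p)) ∩
          (F : Set (Matrix.GeneralLinearGroup (Fin m) (ZMod p) → ℂ)),
        R * t * (χ 1).re ^ 2 ≤ B₂) := by
  sorry

/-- Instantiation: the Lie-cell families of `stub_lieCellFamilies` are shared-wall families
(REAL proof: `rankTests_biInvariant`, `gradedBudget_rankTests_pos`). -/
theorem sharedWall_of_lieCell : SharedWallFamilies := by
  obtain ⟨c, hc, hall⟩ := stub_lieCellFamilies
  refine ⟨c, hc, fun R => ?_⟩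
  obtain ⟨p, hp, m, k, F, B₂, t, X, Y, Z, hF, hB, hsep, ht, hvol, hdeg⟩ := hall R
  subst hF
  have hpos : 0 < B₂ := hB ▸ gradedBudget_rankTests_pos p m k
  exact ⟨Matrix.GeneralLinearGroup (Fin m) (ZMod p), inferInstance, inferInstance, rankTests p m k,
    B₂, t, X, Y, Z, hB, rankTests_biInvariant p m k, hsep, ht, hpos, hvol, hdeg⟩

/-! ## The composition: the line concludes the crux BY NAME -/

/-- Graded STPP families for every `ε > 0` (stub 6 → `sharedWall_of_lieCell` → stub 5). -/
theorem gradedSTPPFamilyAt_all (ε : ℝ) (hε : 0 < ε) : GradedSTPPFamilyAt ε := by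
  obtain ⟨c, hc, hfam⟩ := sharedWall_of_lieCell
  exact stub_shareUniversality c hc hfam ε hε

/-- **COMPOSITION.** `stub_lieCellFamilies → (sharedWall_of_lieCell) → stub_shareUniversality →
GradedSTPPFamilyAt ε → (the lift: stub_powerStep, stub_wreathSeparated, stub_wreathBudget,
stub_amplify) → CruxAt ε`, for every `ε > 0`; concludes `…LevelGradedCohnUmans.GradedDesignFamily`. -/
theorem GradedDesignFamily_of :
    Summit.MatrixMultiplication.MatrixMultiplication.Theses.LevelGradedCohnUmans.GradedDesignFamily :=
  gradedDesignFamily_iff.2 fun ε hε => cruxAt_of_gradedSTPPFamilyAt hε (gradedSTPPFamilyAt_all ε hε)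

end Summit.MatrixMultiplication.MatrixMultiplication.Cruxes.GradedDesignFamily.GradedStppWreath

end
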